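import Literature.MathematicalPhysics.QuantumFieldTheory.Balaban1983to89.CrossoverLedger
import Literature.MathematicalPhysics.QuantumFieldTheory.Balaban1983to89.B16

/-!
# `Balaban1983to89.CrossoverLedgerWC` — the weak-coupling front, instantiated from the typed DAG (statement level)

**Observatory of the non-perturbative crossover; no mass-gap claim.**

Audit cell `pub-balaban`, build IR-3 v2 (TWO-FRONT CROSSOVER LEDGER), seat `b2b-balaban-ir-wc` (weak-coupling front).
Companion markdown: `run/shared/lean/pub/pub-balaban/ir/FRONT-WC.md` (§1 the definition "the flow control certifies at
step k with effective coupling g_k", §1bis the dictionary typed here).  Value = TYPED BOOKKEEPING.  The ledger seat's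
interface `CrossoverLedger.RGFlowControl` / `CrossoverLedger.WeakCouplingFront F β_exit` (module `CrossoverLedger`)
leaves `Controlled`, `betaEff`, `decr` ABSTRACT.  This leaf records, in the kernel, WHICH data of the cell's typed reading
of T. Bałaban's series (`Setup.Flow`, `B12.RunParams`, `B16.Construction`, `B16.RunData.Sect2Form`, `Step.BetaLower`,
`Step.BetaUpper`) instantiate them, and EXACTLY WHICH hypotheses then yield `WeakCouplingFront`, with WHICH `β_exit`.
Nothing of the series is asserted; every analytic input is an explicit, named hypothesis (a field of `FrontData`); the
only theorems are bookkeeping (an induction on the step index and division by `N`).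

CITATION HEADER (lean-in-tree rule 2026-08-18).  (B12) T. Bałaban, *Renormalization group approach to lattice gauge
field theories. I*, Commun. Math. Phys. **109** (1987) 249–301 — used ONLY as LOCATOR of conventions: (0.1) p. 251
(`ε = L^{-K}`), (0.18)–(0.20) pp. 255–256 (effective couplings `g_k`, recursive RG equations
`1/g_k² = 1/g²_{k+1} + β_{k+1}(g_k)`), Thm 1 p. 259 (standing hypothesis `g_k ∈ ]0, γ]`), Thm 2 / (0.31) p. 259 and
p. 264 (two-sided bounds on the `β`-functions — printed WITHOUT proof, "We will investigate other properties in a separate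
paper": the cell's WALL; entering below only as the HYPOTHESES `Step.BetaLower` / `Step.BetaUpper`).  (B14 = [III])
T. Bałaban, *Convergent renormalization expansions for lattice gauge theories*, Commun. Math. Phys. **119** (1988)
243–285, Thm 1 p. 262 (base of the induction, `ρ₀ = exp[−(1/g₀²)A − E]`).  (B16) T. Bałaban, *Large field
renormalization. II*, Commun. Math. Phys. **122** (1989) 355–392, Thm 1 p. 355 and pp. 390–391 (the inductive step,
typed by the cell as `B16.InductionStep` with a WHOLE-RUN interval hypothesis).  None of these is cited for a disputed
step: the step, the base and the β-bounds are HYPOTHESES of the theorems below, never facts.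

UNITS (`ir/UNITS.md` v0.1 §1).  Tree coupling `β_t`; Wilson `β_W = N·β_t = 1/g²` (Bałaban's `g`).  Hence the bare
Bałaban coupling of a run started at tree coupling `β` is `g₀ = (N β)^{-1/2}` (`bareCoupling`), and the effective TREE
coupling after `k` steps is `(1/g_k²)/N` (`effBeta`).

WHAT THIS MODULE DOES.
* §1 PREFIX-LOCAL induction predicates `InductionBasePrefix C γ` (base needs only `g₀ ∈ ]0,γ]`) and
  `InductionStepPrefix C γ` (step `k → k+1` needs only `g₀, …, g_{k+1} ∈ ]0,γ]`), each IMPLYING the cell's whole-run form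
  (`inductionBase_of_prefix`, `inductionStep_of_prefix`, hence `B16.Thm1Printed` via `B16.thm1_of_steps`:
  `thm1Printed_of_prefix`).  Print states Thm 1 with the whole-run hypothesis; a FORWARD-moving front consumes the prefix
  form, which is a STRENGTHENING (causality of the inductive construction) recorded as such — not a quotation.
* §2 the instance `wcFlowControl C N L hL Ksch m d hd : RGFlowControl` — `betaEff β k = (1/g_k²)/N` along the run
  `runOf Ksch m N β = ⟨Ksch β, m, bareCoupling N β⟩` (index frozen at `Ksch β`: at the unit lattice the series has no
  further RG step), `Controlled β k = (k ≤ Ksch β ∧ Sect2Form k)`, `decr = d`.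
* §3 `FrontData C N m Ksch γ b β'` — THE HYPOTHESES, one field each: the bare-coupling convention; the RG equation (0.20)
  with its positive root, along prefixes in ]0,γ] (`next`); `Step.BetaLower b γ` and `Step.BetaUpper β' γ` for every run
  (B12 Thm 2's two halves; UNPROVED in print — the β sub-cell's wall); prefix base and step ([III] Thm 1 / B16 pp. 390–391;
  UNDER AUDIT); the SPACING SCHEDULE `(β − β_exit)/(b/N) + 1 ≤ Ksch β` (the run started at bare `β` has enough RG steps to
  reach the exit before the unit lattice).  Main theorem `weakCouplingFront_of_frontData`:
  `FrontData C N m Ksch γ b β' → WeakCouplingFront (wcFlowControl C N L hL Ksch m (b/N) _) ((1/γ² + β')/N)`.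
  WHY `β_exit = (1/γ² + β')/N` and not print's `(1/γ²)/N`: the ledger's front certifies step `k → k+1` from the incoming
  effective couplings `j ≤ k` only, while the typed step needs `g_{k+1} ≤ γ` as well; one maximal decrement `β'` of `1/g²`
  above the threshold `1/γ²` guarantees it (`FRONT-WC.md` remark R-WC-1).
* §4 NON-VACUITY: `FrontData` is inhabited (`frontData_toy`), so the hypothesis list of the main theorem is consistent, and
  the toy instance is a genuine `WeakCouplingFront` (`weakCouplingFront_toy`).  The toy says nothing about Yang–Mills.

ABSOLUTE RULE.  No internally-minted statement enters as a cited fact; B1–B16 are not cited for any disputed step; no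
number (`γ`, `b`, `β'`, `β_exit`) is claimed — `FRONT-WC.md` records that NONE is certified to date (β_exit UNCERTIFIED);
the fronts' numbers live in `ir/CROSSOVER-LEDGER.md`, never in this file.

VERSION.  v1 = p188424 (2026-08-19, commit 777ecbb9385b; referee-certified t4-ref2 pass 14 C-t4r2-WC1).  v1.1 (2026-08-19,
seat gen 3) = DOCFIX D1 of the adv8-g53 cross-read (GAPS C-adv8-72; certificate
`run/shared/lean/pub/pub-balaban/b2b-balaban-adv8-g53/XREAD-CrossoverLedgerWC-v1.md`): B12 Theorem 1 is printed on p. 259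
(PDF p. 11 of the held text `paper:balaban1987-cmp109-rg-i-small-field`, checked: «Theorem 1. If the sequence of the
effective coupling constants is contained in an interval ]0, γ] …»), not on p. 256 — the two locators saying «p. 256» are
corrected; every declaration, statement and proof is byte-unchanged vs v1.
-/

noncomputable section

open Literature.MathematicalPhysics.QuantumFieldTheory.Balaban1983to89

namespace Literature.MathematicalPhysics.QuantumFieldTheory.Balaban1983to89.CrossoverLedger

/-! ## §1 Prefix-local forms of the induction base and step -/

/-- PREFIX-LOCAL BASE: for every run whose BARE coupling lies in ]0, γ] the density `ρ₀ = exp[−(1/g₀²)A − E]` has the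
§2 [III] form at `k = 0`.  Strengthening of the cell's whole-run `B16.InductionBase` (which assumes `g_0,…,g_K ∈ ]0,γ]`);
used as a HYPOTHESIS only. [cite: Balaban1988Convergent, Thm 1 p.262] -/
def InductionBasePrefix (C : B16.Construction) (γ : ℝ) : Prop :=
  ∀ P : B12.RunParams, (C P).flow.InInterval γ 0 → (C P).Sect2Form 0

/-- PREFIX-LOCAL STEP: for every run and every `k < K`, if the couplings `g_0, …, g_{k+1}` lie in ]0, γ] and the `k`-th
density has the §2 [III] form then so does the `(k+1)`-st.  Strengthening of the cell's whole-run `B16.InductionStep`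
(interval hypothesis on ALL of `g_0,…,g_K`), justified informally by the causality of the inductive construction
(pp. 390–391: step `k → k+1` manipulates `ρ_k` and `g_k, g_{k+1}` only) but NOT a quotation; used as a HYPOTHESIS only.
[cite: Balaban1989LargeFieldII, p.390–391] -/
def InductionStepPrefix (C : B16.Construction) (γ : ℝ) : Prop :=
  ∀ P : B12.RunParams, ∀ k, k < P.K → (C P).flow.InInterval γ (k + 1) →
    (C P).Sect2Form k → (C P).Sect2Form (k + 1)

/-- The prefix-local base implies the whole-run base (bookkeeping: a whole-run interval hypothesis restricts to the
prefix `{0}`). [folklore] -/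
theorem inductionBase_of_prefix {C : B16.Construction} {γ : ℝ} (h : InductionBasePrefix C γ) :
    B16.InductionBase C γ :=
  fun P hP => h P (fun k hk => hP k (hk.trans (Nat.zero_le _)))

/-- The prefix-local step implies the whole-run step (bookkeeping: restrict the whole-run interval hypothesis to the
prefix `{0,…,k+1}`, `k < K`). [folklore] -/
theorem inductionStep_of_prefix {C : B16.Construction} {γ : ℝ} (h : InductionStepPrefix C γ) :
    B16.InductionStep C γ :=
  fun P hP k hk hS => h P k hk (fun j hj => hP j (hj.trans (Nat.succ_le_of_lt hk))) hS

/-- Hence the printed end statement `B16.Thm1Printed` from the prefix-local base and step (via the cell's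
`B16.thm1_of_steps`). [cite: Balaban1989LargeFieldII, Thm 1 p.355] -/
theorem thm1Printed_of_prefix {C : B16.Construction} {γ : ℝ} (hγ : 0 < γ) (hb : InductionBasePrefix C γ)
    (hs : InductionStepPrefix C γ) : B16.Thm1Printed C :=
  B16.thm1_of_steps C γ hγ (inductionBase_of_prefix hb) (inductionStep_of_prefix hs)

/-! ## §2 The dictionary: bare coupling, effective tree coupling, the run, the `RGFlowControl` instance -/

/-- Bare Bałaban coupling of a run started at TREE coupling `β` for the group of rank parameter `N`:
`β_W = N β = 1/g₀²`, i.e. `g₀ = (N β)^{-1/2}` (junk value `1/√(Nβ) = 1/0 = 0` for `N β ≤ 0`; only `β > 0`, `N > 0` is ever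
used).  Convention of `ir/UNITS.md` §1 (`β_W = 2N/g²_YM`, `g_Bal = g_YM/√2`). [cite: Balaban1987RG1, (0.2)/(0.18) pp.251–255] -/
def bareCoupling (N : ℕ) (β : ℝ) : ℝ := 1 / Real.sqrt (N * β)

/-- Effective TREE coupling after `j` RG steps of a run with coupling sequence `g` and `K` steps in all:
`(1/g_{min(j,K)}²)/N` — the Wilson coupling `1/g_j²` of B12 (0.18)–(0.20) in tree units, with the index FROZEN at `K`
(documented junk convention: after the last step, at the unit lattice, nothing runs). [cite: Balaban1987RG1, (0.18)–(0.20) pp.255–256] -/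
def effBeta (N : ℕ) (g : ℕ → ℝ) (K j : ℕ) : ℝ := (1 / (g (min j K)) ^ 2) / N

/-- Below the freezing index `effBeta` is literally `(1/g_j²)/N`. [folklore] -/
theorem effBeta_of_le {N : ℕ} {g : ℕ → ℝ} {K j : ℕ} (h : j ≤ K) : effBeta N g K j = (1 / (g j) ^ 2) / N := by
  simp [effBeta, min_eq_left h]

/-- The run started at tree coupling `β`: `K = Ksch β` RG steps (lattice spacing `ε = L^{-Ksch β}`, B12 (0.1)), torus
exponent `m`, bare coupling `bareCoupling N β`. [cite: Balaban1987RG1, (0.1) p.251] -/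
def runOf (Ksch : ℝ → ℕ) (m N : ℕ) (β : ℝ) : B12.RunParams := ⟨Ksch β, m, bareCoupling N β⟩

/-- THE INSTANCE of the ledger's `RGFlowControl` built from a typed construction `C : B16.Construction`:
block size `L`; `betaEff β k = (1/g_k²)/N` along the run `runOf Ksch m N β` (frozen at `k = Ksch β`);
`Controlled β k := k ≤ Ksch β ∧ (C (runOf Ksch m N β)).Sect2Form k` ("the k-th effective density of the run from bare β
exists as a step of that run and has the §2 [III] form" — `FRONT-WC.md` §1 (D)); certified decrement `d` per step (to be
`b/N` with `b` a `Step.BetaLower` floor).  A definition, no claim. [cite: Balaban1987RG1, (0.19)–(0.20) pp.255–256] -/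
def wcFlowControl (C : B16.Construction) (N L : ℕ) (hL : 1 < L) (Ksch : ℝ → ℕ) (m : ℕ) (d : ℝ) (hd : 0 < d) :
    RGFlowControl where
  L := L
  one_lt_L := hL
  betaEff := fun β k => effBeta N (C (runOf Ksch m N β)).flow.g (Ksch β) k
  Controlled := fun β k => k ≤ Ksch β ∧ (C (runOf Ksch m N β)).Sect2Form k
  decr := d
  decr_pos := hd

/-! ## §3 The hypotheses and the main bookkeeping theorem -/

/-- `FrontData C N m Ksch γ b β'` — EVERYTHING the weak-coupling front needs, as named hypotheses on a typed construction
`C` (nothing here is asserted anywhere in this library):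
* `N_pos`, `γ_pos`, `b_pos`, `b_le` — signs (`0 < b ≤ β'`);
* `bare` — the run `P` starts at its bare coupling: `g_0 = P.g0` (convention (0.18));
* `next` — B12 (0.20) read forward with its positive root: along any prefix `g_0,…,g_k ∈ ]0,γ]` (`k < K`) on which
  `1/g_k² − β_{k+1}(g_k) > 0`, the construction's `g_{k+1}` is the positive solution of `1/g_k² = 1/g²_{k+1} + β_{k+1}(g_k)`;
* `lower`, `upper` — `b ≤ β_j(x) ≤ β'` on ]0,γ] for the β-functions of every run: the two halves of B12 Thm 2 / (0.31)
  (lower half = discrete asymptotic freedom; printed WITHOUT proof, p. 264 — the cell's wall `Step.BetaLower`);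
* `base`, `step` — the prefix-local induction base ([III] Thm 1 p. 262) and step (B16 pp. 390–391), UNDER AUDIT;
* `schedule` — the number of RG steps of the run from bare `β ≥ β_exit := (1/γ² + β')/N` is at least
  `(β − β_exit)/(b/N) + 1`, i.e. the lattice spacing `L^{-Ksch β}` is fine enough for the flow to reach the exit before the
  unit lattice (the asymptotic-freedom scaling of the continuum approach, B12 (0.31)).
[cite: Balaban1987RG1, (0.20) p.256 and Thm 2 (0.31) p.259] -/
structure FrontData (C : B16.Construction) (N m : ℕ) (Ksch : ℝ → ℕ) (γ b β' : ℝ) : Prop where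
  N_pos : 0 < N
  γ_pos : 0 < γ
  b_pos : 0 < b
  b_le : b ≤ β'
  bare : ∀ P : B12.RunParams, (C P).flow.g 0 = P.g0
  next : ∀ P : B12.RunParams, ∀ k, k < P.K → (C P).flow.InInterval γ k →
    0 < 1 / ((C P).flow.g k) ^ 2 - (C P).flow.β (k + 1) ((C P).flow.g k) →
      1 / ((C P).flow.g k) ^ 2 = 1 / ((C P).flow.g (k + 1)) ^ 2 + (C P).flow.β (k + 1) ((C P).flow.g k) ∧
        0 < (C P).flow.g (k + 1)
  lower : ∀ P : B12.RunParams, Step.BetaLower b γ (C P).flow.β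
  upper : ∀ P : B12.RunParams, Step.BetaUpper β' γ (C P).flow.β
  base : InductionBasePrefix C γ
  step : InductionStepPrefix C γ
  schedule : ∀ β : ℝ, (1 / γ ^ 2 + β') / N ≤ β → (β - (1 / γ ^ 2 + β') / N) / (b / N) + 1 ≤ (Ksch β : ℝ)

/-- Elementary: for positive reals, `1/γ² ≤ 1/x²` gives `x ≤ γ`. [folklore] -/
private theorem le_of_one_div_sq_le {x γ : ℝ} (hx : 0 < x) (hγ : 0 < γ) (h : 1 / γ ^ 2 ≤ 1 / x ^ 2) : x ≤ γ := by
  have h2 : x ^ 2 ≤ γ ^ 2 := (one_div_le_one_div (pow_pos hγ 2) (pow_pos hx 2)).1 h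
  nlinarith [add_pos hx hγ]

/-- THE CORE BOOKKEEPING over raw sequences (no structures): from the RG recursion with positive root along prefixes in
]0,γ], two-sided β-bounds `0 < b ≤ β_j ≤ β'` on ]0,γ], prefix base/step for a predicate `S`, a start `(1/g_0²)/N = β ≥
β_exit := (1/γ²+β')/N` and a schedule `K ≥ (β − β_exit)/(b/N) + 1`, the ledger's front clauses hold with decrement `b/N`:
while all effective couplings met so far are `≥ β_exit`, the next index is still `≤ K`, the couplings stay in ]0,γ], `S`
propagates and `effBeta` drops by `≥ b/N`.  Induction on the step index. [folklore] -/
theorem front_core {N : ℕ} (hN : 0 < N) {γ b β' β : ℝ} (hγ : 0 < γ) (hb : 0 < b) (hbβ' : b ≤ β')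
    (g : ℕ → ℝ) (βf : ℕ → ℝ → ℝ) (S : ℕ → Prop) (K : ℕ)
    (h0 : (1 / (g 0) ^ 2) / N = β) (hg0 : 0 < g 0)
    (hnext : ∀ k, k < K → Step.InInterval γ k g → 0 < 1 / (g k) ^ 2 - βf (k + 1) (g k) →
      1 / (g k) ^ 2 = 1 / (g (k + 1)) ^ 2 + βf (k + 1) (g k) ∧ 0 < g (k + 1))
    (hlo : Step.BetaLower b γ βf) (hup : Step.BetaUpper β' γ βf)
    (hbase : Step.InInterval γ 0 g → S 0)
    (hstep : ∀ k, k < K → Step.InInterval γ (k + 1) g → S k → S (k + 1))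
    (hβ : (1 / γ ^ 2 + β') / N ≤ β)
    (hK : (β - (1 / γ ^ 2 + β') / N) / (b / N) + 1 ≤ (K : ℝ)) :
    ((0 ≤ K ∧ S 0) ∧ effBeta N g K 0 = β) ∧
      ∀ k, (∀ j ≤ k, (1 / γ ^ 2 + β') / N ≤ effBeta N g K j) →
        ((k + 1 ≤ K ∧ S (k + 1)) ∧ effBeta N g K (k + 1) ≤ effBeta N g K k - b / N) := by
  have hNr : (0 : ℝ) < N := Nat.cast_pos.2 hN
  have hd : 0 < b / N := div_pos hb hNr
  have hγ2 : 0 < 1 / γ ^ 2 := by positivity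
  -- the start: `g_0 ∈ ]0, γ]`, `S 0`, `effBeta 0 = β`
  have hI0 : Step.InInterval γ 0 g := by
    intro k hk
    obtain rfl : k = 0 := Nat.le_zero.1 hk
    refine ⟨hg0, le_of_one_div_sq_le hg0 hγ ?_⟩
    have h1 : 1 / γ ^ 2 + β' ≤ 1 / (g 0) ^ 2 := by
      have h := hβ
      rw [← h0] at h
      exact (div_le_div_iff_of_pos_right hNr).1 h
    linarith
  have hS0 : S 0 := hbase hI0
  have hE0 : effBeta N g K 0 = β := by rw [effBeta_of_le (Nat.zero_le K)]; exact h0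
  -- one certified step
  have advance : ∀ k, k + 1 ≤ K → Step.InInterval γ k g → S k → (1 / γ ^ 2 + β') / N ≤ effBeta N g K k →
      Step.InInterval γ (k + 1) g ∧ S (k + 1) ∧ effBeta N g K (k + 1) ≤ effBeta N g K k - b / N := by
    intro k hk hI hS hE
    have hkK : k < K := Nat.lt_of_succ_le hk
    obtain ⟨hgk, hgkγ⟩ := hI k le_rfl
    have hEk : effBeta N g K k = (1 / (g k) ^ 2) / N := effBeta_of_le (Nat.le_of_succ_le hk)
    have h1 : 1 / γ ^ 2 + β' ≤ 1 / (g k) ^ 2 := by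
      rw [hEk] at hE
      exact (div_le_div_iff_of_pos_right hNr).1 hE
    have hlo' : b ≤ βf (k + 1) (g k) := hlo (k + 1) (g k) hgk hgkγ
    have hup' : βf (k + 1) (g k) ≤ β' := hup (k + 1) (g k) hgk hgkγ
    have hR : 0 < 1 / (g k) ^ 2 - βf (k + 1) (g k) := by linarith
    obtain ⟨hrg, hgk1⟩ := hnext k hkK hI hR
    have h2 : 1 / γ ^ 2 ≤ 1 / (g (k + 1)) ^ 2 := by linarith
    have hgk1γ : g (k + 1) ≤ γ := le_of_one_div_sq_le hgk1 hγ h2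
    have hI' : Step.InInterval γ (k + 1) g := by
      intro j hj
      rcases Nat.of_le_succ hj with hj' | hj'
      · exact hI j hj'
      · rw [hj']
        exact ⟨hgk1, hgk1γ⟩
    refine ⟨hI', hstep k hkK hI' hS, ?_⟩
    rw [effBeta_of_le hk, hEk]
    have h3 : 1 / (g (k + 1)) ^ 2 ≤ 1 / (g k) ^ 2 - b := by linarith
    have h4 := div_le_div_of_nonneg_right h3 hNr.le
    rwa [sub_div] at h4
  -- the invariant, by induction on k
  have claim : ∀ k, (∀ j ≤ k, (1 / γ ^ 2 + β') / N ≤ effBeta N g K j) →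
      (k + 1 ≤ K ∧ Step.InInterval γ (k + 1) g ∧ S (k + 1) ∧
        effBeta N g K (k + 1) ≤ effBeta N g K k - b / N ∧
        effBeta N g K (k + 1) ≤ β - ((k : ℝ) + 1) * (b / N)) := by
    intro k
    induction k with
    | zero =>
      intro hpre
      have hE : (1 / γ ^ 2 + β') / N ≤ effBeta N g K 0 := hpre 0 le_rfl
      have hK1 : 0 + 1 ≤ K := by
        have h : (0 : ℝ) ≤ (β - (1 / γ ^ 2 + β') / N) / (b / N) := div_nonneg (by linarith) hd.le
        have h' : (1 : ℝ) ≤ K := by linarith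
        have h'' : 1 ≤ K := by exact_mod_cast h'
        simpa using h''
      obtain ⟨hI', hS', hdec⟩ := advance 0 hK1 hI0 hS0 hE
      refine ⟨hK1, hI', hS', hdec, ?_⟩
      rw [hE0] at hdec
      push_cast
      linarith
    | succ k ih =>
      intro hpre
      have hpre' : ∀ j ≤ k, (1 / γ ^ 2 + β') / N ≤ effBeta N g K j :=
        fun j hj => hpre j (hj.trans (Nat.le_succ k))
      obtain ⟨-, hI1, hS1, -, hlin⟩ := ih hpre'
      have hE : (1 / γ ^ 2 + β') / N ≤ effBeta N g K (k + 1) := hpre (k + 1) le_rfl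
      have hk2 : k + 1 + 1 ≤ K := by
        have h1 : ((k : ℝ) + 1) * (b / N) ≤ β - (1 / γ ^ 2 + β') / N := by linarith
        have h2 : (k : ℝ) + 1 ≤ (β - (1 / γ ^ 2 + β') / N) / (b / N) := (le_div_iff₀ hd).2 h1
        have h3 : (k : ℝ) + 1 + 1 ≤ (K : ℝ) := by linarith
        exact_mod_cast h3
      obtain ⟨hI2, hS2, hdec⟩ := advance (k + 1) hk2 hI1 hS1 hE
      refine ⟨hk2, hI2, hS2, hdec, ?_⟩
      push_cast at hlin ⊢
      linarith
  refine ⟨⟨⟨Nat.zero_le K, hS0⟩, hE0⟩, fun k hpre => ?_⟩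
  obtain ⟨hk1, -, hS1, hdec, -⟩ := claim k hpre
  exact ⟨⟨hk1, hS1⟩, hdec⟩

/-- **MAIN BOOKKEEPING THEOREM.**  Under `FrontData C N m Ksch γ b β'` the instance `wcFlowControl C N L hL Ksch m (b/N) _`
is a `WeakCouplingFront` at `β_exit = (1/γ² + β')/N` (tree units).  Every analytic input is a field of the hypothesis; the
proof is `front_core` applied to the run `runOf Ksch m N β`.  NO NUMBER is claimed: whether any `γ, b, β'` make `FrontData`
true for T. Bałaban's construction is exactly what the audit cell records as UNCERTIFIED (`ir/FRONT-WC.md` §2–§3).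
[cite: Balaban1987RG1, Thm 1 p.259 and Thm 2 (0.31) p.259] -/
theorem weakCouplingFront_of_frontData {C : B16.Construction} {N m : ℕ} {Ksch : ℝ → ℕ} {γ b β' : ℝ}
    (H : FrontData C N m Ksch γ b β') (L : ℕ) (hL : 1 < L) :
    WeakCouplingFront
      (wcFlowControl C N L hL Ksch m (b / N) (div_pos H.b_pos (Nat.cast_pos.2 H.N_pos)))
      ((1 / γ ^ 2 + β') / N) := by
  intro β hβ
  have hN : 0 < N := H.N_pos
  have hNr : (0 : ℝ) < N := Nat.cast_pos.2 hN
  have hβ'pos : 0 < β' := H.b_pos.trans_le H.b_le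
  have hγ := H.γ_pos
  have hβe_pos : 0 < (1 / γ ^ 2 + β') / N := by positivity
  have hβpos : 0 < β := hβe_pos.trans_le hβ
  have hNβ : 0 < (N : ℝ) * β := mul_pos hNr hβpos
  have hg0eq : (C (runOf Ksch m N β)).flow.g 0 = bareCoupling N β := H.bare (runOf Ksch m N β)
  have hg0pos : 0 < (C (runOf Ksch m N β)).flow.g 0 := by
    rw [hg0eq]
    exact one_div_pos.2 (Real.sqrt_pos.2 hNβ)
  have h0 : (1 / ((C (runOf Ksch m N β)).flow.g 0) ^ 2) / N = β := by
    rw [hg0eq, bareCoupling, one_div_pow, Real.sq_sqrt hNβ.le, one_div_one_div, mul_div_cancel_left₀ β hNr.ne']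
  exact front_core hN hγ H.b_pos H.b_le (C (runOf Ksch m N β)).flow.g (C (runOf Ksch m N β)).flow.β
    (fun k => (C (runOf Ksch m N β)).Sect2Form k) (Ksch β) h0 hg0pos
    (fun k hk hI hR => H.next (runOf Ksch m N β) k hk hI hR)
    (H.lower (runOf Ksch m N β)) (H.upper (runOf Ksch m N β)) (H.base (runOf Ksch m N β))
    (fun k hk hI hS => H.step (runOf Ksch m N β) k hk hI hS) hβ (H.schedule β hβ)

/-- Reading aid: under `FrontData`, control at step `k` of the run from bare `β` in the instance MEANS `k ≤ Ksch β` and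
the §2 [III] form of the `k`-th density (definitional unfolding, recorded so referees can cite it). [folklore] -/
theorem controlled_iff (C : B16.Construction) (N L : ℕ) (hL : 1 < L) (Ksch : ℝ → ℕ) (m : ℕ) (d : ℝ) (hd : 0 < d)
    (β : ℝ) (k : ℕ) :
    (wcFlowControl C N L hL Ksch m d hd).Controlled β k ↔ (k ≤ Ksch β ∧ (C (runOf Ksch m N β)).Sect2Form k) :=
  Iff.rfl

/-! ## §4 Non-vacuity: the hypothesis list `FrontData` is consistent -/

/-- Toy coupling sequence: `g_0 = g0`, and `g_{k+1}` the positive root of `1/g_k² = 1/g²_{k+1} + b` whenever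
`1/g_k² − b > 0` (else frozen — documented junk branch, never reached in the toy front). [folklore] -/
def toySeq (b g0 : ℝ) : ℕ → ℝ
  | 0 => g0
  | k + 1 => if 0 < 1 / (toySeq b g0 k) ^ 2 - b then 1 / Real.sqrt (1 / (toySeq b g0 k) ^ 2 - b) else toySeq b g0 k

/-- Toy "construction": couplings `toySeq b P.g0`, constant β-functions `b`, trivial configuration data, and
`Sect2Form := True`.  It models the LOGICAL SHAPE of `FrontData` only. [folklore] -/
def toyConstruction (b : ℝ) : B16.Construction := fun P =>
  { flow := ⟨toySeq b P.g0, fun _ _ => b⟩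
    Cfg := fun _ => Unit
    dom := fun _ => Set.univ
    effAction := fun _ _ => 0
    wilsonBG := fun _ _ => 0
    Ek := fun _ _ => 0
    numSites := fun _ => 0
    Repr := fun _ => True
    IndAss := fun _ => True
    ρ := fun _ _ => 0
    χ := fun _ _ => 0
    Sect2Form := fun _ => True }

/-- `FrontData` is inhabited: the toy construction with `N = 1`, `m = 0`, schedule `Ksch β = ⌈β⌉₊ + 1`, `γ = 1/2`,
`b = β' = 1` (so `β_exit = 5`).  Hence the hypotheses of `weakCouplingFront_of_frontData` are jointly consistent
(non-vacuity certificate; says nothing about Yang–Mills). [folklore] -/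
theorem frontData_toy : FrontData (toyConstruction 1) 1 0 (fun β => ⌈β⌉₊ + 1) (1 / 2) 1 1 where
  N_pos := Nat.one_pos
  γ_pos := by norm_num
  b_pos := one_pos
  b_le := le_rfl
  bare := fun _ => rfl
  next := by
    intro P k _ _ hR
    change 0 < 1 / (toySeq 1 P.g0 k) ^ 2 - 1 at hR
    change 1 / (toySeq 1 P.g0 k) ^ 2 = 1 / (toySeq 1 P.g0 (k + 1)) ^ 2 + 1 ∧ 0 < toySeq 1 P.g0 (k + 1)
    have hk1 : toySeq 1 P.g0 (k + 1) = 1 / Real.sqrt (1 / (toySeq 1 P.g0 k) ^ 2 - 1) := by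
      rw [toySeq, if_pos hR]
    rw [hk1, one_div_pow, Real.sq_sqrt hR.le, one_div_one_div]
    exact ⟨by ring, one_div_pos.2 (Real.sqrt_pos.2 hR)⟩
  lower := fun _ _ _ _ _ => le_rfl
  upper := fun _ _ _ _ _ => le_rfl
  base := fun _ _ => trivial
  step := fun _ _ _ _ _ => trivial
  schedule := by
    intro β _
    have h := Nat.le_ceil β
    push_cast
    norm_num
    linarith

/-- … and therefore the toy instance is a `WeakCouplingFront` at `β_exit = (1/(1/2)² + 1)/1` with block size `L = 13`,
decrement `1/1` (an inhabited instance of the ledger's front predicate built through `wcFlowControl`). [folklore] -/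
theorem weakCouplingFront_toy :
    WeakCouplingFront
      (wcFlowControl (toyConstruction 1) 1 13 (by norm_num) (fun β => ⌈β⌉₊ + 1) 0 ((1 : ℝ) / (1 : ℕ))
        (div_pos frontData_toy.b_pos (Nat.cast_pos.2 frontData_toy.N_pos)))
      ((1 / (1 / 2 : ℝ) ^ 2 + 1) / (1 : ℕ)) :=
  weakCouplingFront_of_frontData frontData_toy 13 (by norm_num)

end Literature.MathematicalPhysics.QuantumFieldTheory.Balaban1983to89.CrossoverLedger
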